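import Mathlib
import Summits.Ventures.PercRepro2.Defs
import Summits.Ventures.PercRepro2.Independence
import Summits.Ventures.PercRepro2.Harris
import Summits.Ventures.PercRepro2.Graph
import Summits.Ventures.PercRepro2.Events
import Summits.Ventures.PercRepro2.Induced
import Summits.Ventures.PercRepro2.ObsIndependence
import Summits.Ventures.PercRepro2.BHK
import Summits.Ventures.PercRepro2.BHKEvents
import Summits.Ventures.PercRepro2.Explore
import Summits.Ventures.PercRepro2.BHKPair
import Summits.Ventures.PercRepro2.CondRecords

/-!
# The record decomposition of the product-sum statement (PS): the pinned-model lemma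
(blind cell PercRepro2, mine-2 g19; conjectures/MINE-2.md M2-39 «2′C4SUM», proofs/MINE2-JOINTPA.md §9;
ASSIGNMENTS v12.64 «write the record law ρ and the four conditional probabilities as a pinned-model
lemma first»)

Setting: finite weighted bond percolation (`expect p`), roots `a₁ ≠ a₂`, `Q = {a₂ ↮ a₁}`,
`U = {u ∈ C₂}`, and the cluster functionals `π₁v(W) = P(v ∈ C₁ in G ∖ W)` (`delConn p ends a₁ v`),
`v ∈ {b, o}`.  One half of (PS) is

  `psHalf = E[(π₁b(C₂) − c)(π₁o(C₂) − d) · 1_{Q ∩ U}]`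

(the other half is the mirror `a₁ ↔ a₂`; (PS) centres at `c = E[π₁b(C₂) | Q] = P(b ∈ C₁ | Q)`,
`condMean_delConn_eq_prob`).

* The generic algebra (`CondRecords.lean`): `E[(f − c)(g − d) 1_A] = P(A) · (Cov(f, g | A) +
  (E[f | A] − c)(E[g | A] − d))` (`condMean`, `condCov`), summed over the records of ANY stopping rule
  (`Explore.StoppingRule`, `expect_eq_sum_records`) with the pinned laws `p_T` and the record weights
  `recWeight p T A = P(cyl T ∩ A)`; `Σ_T recWeight = P(A)` (the record law); `psHalf_eq` below.
* `covForm_nonneg`: when the rule DECIDES `U` given `Q` (`DecidesGiven`: on every record `Q ∩ cyl T`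
  lies in `U` or in `Uᶜ` — the exploration of `C(u)` halted at the first root does: reached `a₂` /
  reached `a₁` / reached no root, `decidesGiven_of_reach`), every within-record covariance
  `Cov_{p_T}(π₁b(C₂), π₁o(C₂) | Q ∩ U)` is `≥ 0`: BHK06 Theorem 1.3 at the pinned law `p_T` for two
  DEcreasing cluster functionals (`bhk_same_cluster_anti`, via `1 − F`).
* **`psHalf_ge_recForm`** / **`ps_ge_recForm`**: `psHalf ≥ Σ_T P(T, Q, u ∈ C₂) · (X_T − c)(Y_T − d)`
  with `X_T = E[π₁b(C₂) | T, Q ∩ U]`, `Y_T = E[π₁o(C₂) | T, Q ∩ U]` — the RECORD FORM; so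
  `(PS) ≥ (PS_rec)` and `(PS_rec) ≥ 0` implies `(PS) ≥ 0` (`ps_nonneg_of_recForm_nonneg`).
* `condMean_delConn_eq`: on a record all of whose explored edges touch `C₂` (every record of the
  u-exploration that reached `a₂`), `X_T = P(b ∈ C₁ | T, Q)` — the tower identity at the pinned law
  (`BHKPair.expect_pair_mul_indicator (T.weights p)`) plus `expect_eq_of_dependsOn_of_eqOn` (an
  observable of `G ∖ W` has the same law under `p` and `p_T` when `T.explored ⊆ touches W`): the
  «four conditional probabilities» of (PS_rec) are the conditional connection probabilities given
  the record.

Nothing about the sign of the record form is claimed; (PS_rec) is the cell's open statement of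
record (M2-39).
-/

namespace Summit.Ventures.PercRepro2

namespace PSRecords

open CondRecords

/-! ## BHK 1.3 for decreasing cluster functionals -/

section BHK

variable {V : Type*} {E : Type*} [Fintype E] [DecidableEq E] [Fintype V] [DecidableEq V]
  {R : Type*} [Field R] [LinearOrder R] [IsStrictOrderedRing R]

/-- **BHK 1.3 for two decreasing functionals** (via `1 − F`, `1 − G` in `bhk_same_cluster`):
`E[F(C_s) 1_Q] · E[G(C_s) 1_Q] ≤ E[(F G)(C_s) 1_Q] · P(Q)`, `Q = {s ↮ t}`, for antitone `F, G`
bounded by `1`. -/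
theorem bhk_same_cluster_anti (p : E → R) (hp : IsProbVec p) (ends : E → Sym2 V) (s t : V)
    {F G : Set V → R} (hF : Antitone F) (hG : Antitone G) (hF1 : ∀ W, F W ≤ 1)
    (hG1 : ∀ W, G W ≤ 1) :
    expect p (fun ω => F (cluster ends ω s) * ((connEvent ends s t)ᶜ).indicator 1 ω) *
        expect p (fun ω => G (cluster ends ω s) * ((connEvent ends s t)ᶜ).indicator 1 ω) ≤
      expect p (fun ω => F (cluster ends ω s) * G (cluster ends ω s) *
          ((connEvent ends s t)ᶜ).indicator 1 ω) * prob p (connEvent ends s t)ᶜ := by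
  have key := bhk_same_cluster p hp ends s t (F₁ := fun W => 1 - F W) (F₂ := fun W => 1 - G W)
    (fun _ _ h => sub_le_sub_left (hF h) 1) (fun _ _ h => sub_le_sub_left (hG h) 1)
    (fun W => sub_nonneg.2 (hF1 W)) (fun W => sub_nonneg.2 (hG1 W))
  beta_reduce at key
  have e1 : expect p (fun ω => (1 - F (cluster ends ω s)) * ((connEvent ends s t)ᶜ).indicator 1 ω) =
      prob p (connEvent ends s t)ᶜ -
        expect p (fun ω => F (cluster ends ω s) * ((connEvent ends s t)ᶜ).indicator 1 ω) := by
    rw [prob_eq_expect_indicator]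
    unfold expect
    rw [← Finset.sum_sub_distrib]
    exact Finset.sum_congr rfl fun ω _ => by ring
  have e2 : expect p (fun ω => (1 - G (cluster ends ω s)) * ((connEvent ends s t)ᶜ).indicator 1 ω) =
      prob p (connEvent ends s t)ᶜ -
        expect p (fun ω => G (cluster ends ω s) * ((connEvent ends s t)ᶜ).indicator 1 ω) := by
    rw [prob_eq_expect_indicator]
    unfold expect
    rw [← Finset.sum_sub_distrib]
    exact Finset.sum_congr rfl fun ω _ => by ring
  have e12 : expect p (fun ω => (1 - F (cluster ends ω s)) * (1 - G (cluster ends ω s)) *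
      ((connEvent ends s t)ᶜ).indicator 1 ω) =
      prob p (connEvent ends s t)ᶜ -
        expect p (fun ω => F (cluster ends ω s) * ((connEvent ends s t)ᶜ).indicator 1 ω) -
        expect p (fun ω => G (cluster ends ω s) * ((connEvent ends s t)ᶜ).indicator 1 ω) +
        expect p (fun ω => F (cluster ends ω s) * G (cluster ends ω s) *
          ((connEvent ends s t)ᶜ).indicator 1 ω) := by
    rw [prob_eq_expect_indicator]
    unfold expect
    rw [← Finset.sum_sub_distrib, ← Finset.sum_sub_distrib, ← Finset.sum_add_distrib]
    exact Finset.sum_congr rfl fun ω _ => by ring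
  rw [e1, e2, e12] at key
  nlinarith [key]

/-- `Cov(F(C_s), G(C_s) | s ↮ t) ≥ 0` for antitone `F, G` bounded by `1` — BHK 1.3 as a
conditional covariance. -/
theorem condCov_nonneg_anti (p : E → R) (hp : IsProbVec p) (ends : E → Sym2 V) (s t : V)
    {F G : Set V → R} (hF : Antitone F) (hG : Antitone G) (hF1 : ∀ W, F W ≤ 1)
    (hG1 : ∀ W, G W ≤ 1) :
    0 ≤ condCov p (connEvent ends s t)ᶜ (fun ω => F (cluster ends ω s))
      (fun ω => G (cluster ends ω s)) :=
  condCov_nonneg_of_bracket hp _ (bhk_same_cluster_anti p hp ends s t hF hG hF1 hG1)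

end BHK

/-! ## The percolation instance: the halves of (PS) and their record forms -/

section Perc

variable {V : Type*} {E : Type*} [Fintype E] [DecidableEq E] [Fintype V] [DecidableEq V]
  {R : Type*} [Field R] [LinearOrder R] [IsStrictOrderedRing R]

omit [Fintype V] [DecidableEq V] [LinearOrder R] [IsStrictOrderedRing R] in
/-- `π_r v (W) = P(v ∈ C_r in G ∖ W)`: the probability that `v` is connected to the root `r` after
closing every edge touching the explored cluster `W` (`delClusterProb` at the up-set `{K | v ∈ K}`). -/
noncomputable def delConn (p : E → R) (ends : E → Sym2 V) (r v : V) (W : Set V) : R :=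
  delClusterProb p ends r {K : Set V | v ∈ K} W

omit [Fintype V] [DecidableEq V] [LinearOrder R] [IsStrictOrderedRing R] in
/-- `π_r v (W)` as an expectation of an indicator of the cluster of `r` in `G ∖ W`. -/
lemma delConn_eq_expect (p : E → R) (ends : E → Sym2 V) (r v : V) (W : Set V) :
    delConn p ends r v W =
      expect p (fun ω => ({K : Set V | v ∈ K} : Set (Set V)).indicator 1
        (cluster ends (delConfig ends W ω) r)) := by
  unfold delConn delClusterProb
  rw [prob_eq_expect_indicator]
  unfold expect
  refine Finset.sum_congr rfl fun ω _ => ?_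
  beta_reduce
  by_cases h : v ∈ cluster ends (delConfig ends W ω) r
  · simp only [Set.indicator_of_mem (show ω ∈ {ω | cluster ends (delConfig ends W ω) r ∈
        {K : Set V | v ∈ K}} from h),
      Set.indicator_of_mem (show cluster ends (delConfig ends W ω) r ∈ {K : Set V | v ∈ K} from h),
      Pi.one_apply]
  · simp only [Set.indicator_of_notMem (show ω ∉ {ω | cluster ends (delConfig ends W ω) r ∈
        {K : Set V | v ∈ K}} from h),
      Set.indicator_of_notMem (show cluster ends (delConfig ends W ω) r ∉ {K : Set V | v ∈ K}
        from h)]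

omit [Fintype V] [DecidableEq V] in
/-- `π_r v` is decreasing in the explored cluster. -/
lemma delConn_antitone {p : E → R} (hp : IsProbVec p) (ends : E → Sym2 V) (r v : V) :
    Antitone (delConn p ends r v) := by
  intro W W' h
  unfold delConn delClusterProb
  refine prob_mono hp fun ω hω => ?_
  exact cluster_mono (ends := ends) (delConfig_anti h ω) r hω

omit [Fintype V] [DecidableEq V] in
/-- `0 ≤ π_r v (W)`. -/
lemma delConn_nonneg {p : E → R} (hp : IsProbVec p) (ends : E → Sym2 V) (r v : V) (W : Set V) :
    0 ≤ delConn p ends r v W :=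
  prob_nonneg hp _

omit [Fintype V] [DecidableEq V] in
/-- `π_r v (W) ≤ 1`. -/
lemma delConn_le_one {p : E → R} (hp : IsProbVec p) (ends : E → Sym2 V) (r v : V) (W : Set V) :
    delConn p ends r v W ≤ 1 :=
  prob_le_one hp _

omit [Fintype V] [DecidableEq V] [LinearOrder R] [IsStrictOrderedRing R] in
/-- One half of (PS): the `a₁`-side functionals weighted by `u ∈ C₂`,
`E[(π₁b(C₂) − c)(π₁o(C₂) − d) · 1_{a₂ ↮ a₁} · 1_{u ∈ C₂}]`. -/
noncomputable def psHalf (p : E → R) (ends : E → Sym2 V) (a₁ a₂ u b o : V) (c d : R) : R :=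
  expect p (fun ω => (delConn p ends a₁ b (cluster ends ω a₂) - c) *
    (delConn p ends a₁ o (cluster ends ω a₂) - d) *
    ((connEvent ends a₂ a₁)ᶜ ∩ connEvent ends a₂ u).indicator 1 ω)

omit [Fintype V] [DecidableEq V] [LinearOrder R] [IsStrictOrderedRing R] in
/-- The record form of one half: `Σ_T P(T, Q, u ∈ C₂) · (X_T − c)(Y_T − d)` with
`X_T = E[π₁b(C₂) | T, Q ∩ U]`, `Y_T = E[π₁o(C₂) | T, Q ∩ U]`. -/
noncomputable def recForm (rule : Explore.StoppingRule E) (p : E → R) (ends : E → Sym2 V)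
    (a₁ a₂ u b o : V) (c d : R) : R :=
  ∑ T ∈ rule.records, recWeight p T ((connEvent ends a₂ a₁)ᶜ ∩ connEvent ends a₂ u) *
    ((condMean (T.weights p) ((connEvent ends a₂ a₁)ᶜ ∩ connEvent ends a₂ u)
        (fun ω => delConn p ends a₁ b (cluster ends ω a₂)) - c) *
      (condMean (T.weights p) ((connEvent ends a₂ a₁)ᶜ ∩ connEvent ends a₂ u)
        (fun ω => delConn p ends a₁ o (cluster ends ω a₂)) - d))

omit [Fintype V] [DecidableEq V] [LinearOrder R] [IsStrictOrderedRing R] in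
/-- The within-record covariance part of one half:
`Σ_T P(T, Q, u ∈ C₂) · Cov_{p_T}(π₁b(C₂), π₁o(C₂) | Q ∩ U)`. -/
noncomputable def covForm (rule : Explore.StoppingRule E) (p : E → R) (ends : E → Sym2 V)
    (a₁ a₂ u b o : V) : R :=
  ∑ T ∈ rule.records, recWeight p T ((connEvent ends a₂ a₁)ᶜ ∩ connEvent ends a₂ u) *
    condCov (T.weights p) ((connEvent ends a₂ a₁)ᶜ ∩ connEvent ends a₂ u)
      (fun ω => delConn p ends a₁ b (cluster ends ω a₂))
      (fun ω => delConn p ends a₁ o (cluster ends ω a₂))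

omit [Fintype V] [DecidableEq V] in
/-- **The pinned-model identity**: `psHalf = covForm + recForm` for every stopping rule. -/
theorem psHalf_eq (rule : Explore.StoppingRule E) {p : E → R} (hp : IsProbVec p)
    (ends : E → Sym2 V) (a₁ a₂ u b o : V) (c d : R) :
    psHalf p ends a₁ a₂ u b o c d =
      covForm rule p ends a₁ a₂ u b o + recForm rule p ends a₁ a₂ u b o c d := by
  unfold psHalf covForm recForm
  rw [expect_centred_mul_indicator_eq_sum_records rule hp, ← Finset.sum_add_distrib]
  exact Finset.sum_congr rfl fun T _ => by ring

/-- **The within-record covariances are nonnegative** when the rule decides `{u ∈ C₂}` given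
`{a₂ ↮ a₁}`: on a record with `u ∈ C₂` forced, `Cov(· | T, Q ∩ U) = Cov(· | T, Q) ≥ 0` by BHK 1.3 at
the pinned law for the two decreasing functionals `π₁b, π₁o`; on a record with `u ∉ C₂` forced on
`Q`, the covariance vanishes. -/
theorem covForm_nonneg (rule : Explore.StoppingRule E) {p : E → R} (hp : IsProbVec p)
    (ends : E → Sym2 V) (a₁ a₂ u b o : V)
    (hdec : DecidesGiven rule (connEvent ends a₂ a₁)ᶜ (connEvent ends a₂ u)) :
    0 ≤ covForm rule p ends a₁ a₂ u b o := by
  unfold covForm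
  refine Finset.sum_nonneg fun T hT => mul_nonneg (recWeight_nonneg hp T _) ?_
  rcases hdec T hT with hU | hU
  · rw [condCov_weights_inter_eq T p hU]
    exact condCov_nonneg_anti (T.weights p) (Explore.isProbVec_weights T hp) ends a₂ a₁
      (delConn_antitone hp ends a₁ b) (delConn_antitone hp ends a₁ o)
      (delConn_le_one hp ends a₁ b) (delConn_le_one hp ends a₁ o)
  · rw [condCov_weights_eq_zero_of_disjoint T p hU]

/-- **One half of (PS) dominates its record form**: `recForm ≤ psHalf` for every stopping rule
deciding `{u ∈ C₂}` given `{a₂ ↮ a₁}`. -/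
theorem psHalf_ge_recForm (rule : Explore.StoppingRule E) {p : E → R} (hp : IsProbVec p)
    (ends : E → Sym2 V) (a₁ a₂ u b o : V) (c d : R)
    (hdec : DecidesGiven rule (connEvent ends a₂ a₁)ᶜ (connEvent ends a₂ u)) :
    recForm rule p ends a₁ a₂ u b o c d ≤ psHalf p ends a₁ a₂ u b o c d := by
  rw [psHalf_eq rule hp]
  linarith [covForm_nonneg rule hp ends a₁ a₂ u b o hdec]

omit [Fintype V] [DecidableEq V] [LinearOrder R] [IsStrictOrderedRing R] in
/-- (PS) as the sum of its two halves (the second half swaps the roots: the `a₂`-side functionals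
weighted by `u ∈ C₁`). -/
noncomputable def ps (p : E → R) (ends : E → Sym2 V) (a₁ a₂ u b o : V) (c₁ d₁ c₂ d₂ : R) : R :=
  psHalf p ends a₁ a₂ u b o c₁ d₁ + psHalf p ends a₂ a₁ u b o c₂ d₂

/-- **(PS) ≥ (PS_rec)**: for stopping rules deciding `{u ∈ C₂}` given `{a₂ ↮ a₁}` and `{u ∈ C₁}`
given `{a₁ ↮ a₂}` (one exploration of `C(u)` halted at the first root serves both), (PS) dominates
the sum of the two record forms. -/
theorem ps_ge_recForm (rule₁ rule₂ : Explore.StoppingRule E) {p : E → R} (hp : IsProbVec p)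
    (ends : E → Sym2 V) (a₁ a₂ u b o : V) (c₁ d₁ c₂ d₂ : R)
    (h₁ : DecidesGiven rule₁ (connEvent ends a₂ a₁)ᶜ (connEvent ends a₂ u))
    (h₂ : DecidesGiven rule₂ (connEvent ends a₁ a₂)ᶜ (connEvent ends a₁ u)) :
    recForm rule₁ p ends a₁ a₂ u b o c₁ d₁ + recForm rule₂ p ends a₂ a₁ u b o c₂ d₂ ≤
      ps p ends a₁ a₂ u b o c₁ d₁ c₂ d₂ :=
  add_le_add (psHalf_ge_recForm rule₁ hp ends a₁ a₂ u b o c₁ d₁ h₁)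
    (psHalf_ge_recForm rule₂ hp ends a₂ a₁ u b o c₂ d₂ h₂)

/-- **(PS_rec) ≥ 0 implies (PS) ≥ 0.** -/
theorem ps_nonneg_of_recForm_nonneg (rule₁ rule₂ : Explore.StoppingRule E) {p : E → R}
    (hp : IsProbVec p) (ends : E → Sym2 V) (a₁ a₂ u b o : V) (c₁ d₁ c₂ d₂ : R)
    (h₁ : DecidesGiven rule₁ (connEvent ends a₂ a₁)ᶜ (connEvent ends a₂ u))
    (h₂ : DecidesGiven rule₂ (connEvent ends a₁ a₂)ᶜ (connEvent ends a₁ u))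
    (h : 0 ≤ recForm rule₁ p ends a₁ a₂ u b o c₁ d₁ + recForm rule₂ p ends a₂ a₁ u b o c₂ d₂) :
    0 ≤ ps p ends a₁ a₂ u b o c₁ d₁ c₂ d₂ :=
  h.trans (ps_ge_recForm rule₁ rule₂ hp ends a₁ a₂ u b o c₁ d₁ c₂ d₂ h₁ h₂)

omit [Fintype V] [DecidableEq V] [LinearOrder R] [IsStrictOrderedRing R] in
/-- The exploration of `C(u)` halted at the first root decides `{u ∈ C₂}` given `{a₂ ↮ a₁}`: a
record that reached `a₂` (its explored open edges join `u` to `a₂`) has `u ∈ C₂` on its cylinder;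
one that reached `a₁` has `u ∈ C₁`, hence `u ∉ C₂` on `Q`; one that reached no root has `u` joined
to neither. -/
theorem decidesGiven_of_reach (rule : Explore.StoppingRule E) (ends : E → Sym2 V) (a₁ a₂ u : V)
    (h : ∀ T ∈ rule.records, (∀ ω ∈ T.cyl, Conn ends ω a₂ u) ∨ (∀ ω ∈ T.cyl, Conn ends ω a₁ u) ∨
      (∀ ω ∈ T.cyl, ¬ Conn ends ω a₁ u ∧ ¬ Conn ends ω a₂ u)) :
    DecidesGiven rule (connEvent ends a₂ a₁)ᶜ (connEvent ends a₂ u) := by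
  intro T hT
  rcases h T hT with h2 | h1 | h0
  · exact Or.inl fun ω hω _ => h2 ω hω
  · exact Or.inr fun ω hω hQ hU => hQ (conn_trans hU (conn_symm (h1 ω hω)))
  · exact Or.inr fun ω hω _ hU => (h0 ω hω).2 hU

end Perc

/-! ## The four conditional probabilities: `X_T = P(b ∈ C₁ | T, Q)` -/

section Tower

variable {V : Type*} {E : Type*} [Fintype E] [DecidableEq E] [Fintype V] [DecidableEq V]
  {R : Type*} [Field R] [LinearOrder R] [IsStrictOrderedRing R]

omit [DecidableEq V] [LinearOrder R] [IsStrictOrderedRing R] in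
/-- **The tower identity at the pinned law**: on a record all of whose explored edges touch the
cluster of `a₂` (on its cylinder), `E_{p_T}[π₁v(C₂) 1_Q] = E_{p_T}[1_{v ∈ C₁} 1_Q]`, `Q = {a₂ ↮ a₁}`
— `BHKPair.expect_pair_mul_indicator` at `p_T`, and the `G ∖ C₂`-observable `1_{v ∈ C₁ in G ∖ C₂}`
has the same expectation under `p` and `p_T` (`expect_eq_of_dependsOn_of_eqOn`). -/
theorem expect_weights_delConn_mul_indicator (T : Explore.Record E) (p : E → R)
    (ends : E → Sym2 V) (a₁ a₂ v : V)
    (hT : ∀ ω ∈ T.cyl, ∀ e ∈ T.explored, e ∈ touches ends (cluster ends ω a₂)) :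
    expect (T.weights p) (fun ω => delConn p ends a₁ v (cluster ends ω a₂) *
        ((connEvent ends a₂ a₁)ᶜ).indicator 1 ω) =
      expect (T.weights p) (fun ω => (connEvent ends a₁ v).indicator 1 ω *
        ((connEvent ends a₂ a₁)ᶜ).indicator 1 ω) := by
  classical
  have h1 := BHKPair.expect_pair_mul_indicator (T.weights p) ends a₂ a₁
    (fun _ K => ({K' : Set V | v ∈ K'} : Set (Set V)).indicator 1 K)
  beta_reduce at h1
  have hL : (fun ω => (connEvent ends a₁ v).indicator (1 : Config E → R) ω *
      ((connEvent ends a₂ a₁)ᶜ).indicator 1 ω) =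
      fun ω => ({K' : Set V | v ∈ K'} : Set (Set V)).indicator 1 (cluster ends ω a₁) *
        ((connEvent ends a₂ a₁)ᶜ).indicator 1 ω := by
    funext ω
    by_cases hv : Conn ends ω a₁ v
    · simp only [Set.indicator_of_mem (show ω ∈ connEvent ends a₁ v from hv),
        Set.indicator_of_mem (show cluster ends ω a₁ ∈ {K' : Set V | v ∈ K'} from hv), Pi.one_apply]
    · simp only [Set.indicator_of_notMem (show ω ∉ connEvent ends a₁ v from hv),
        Set.indicator_of_notMem (show cluster ends ω a₁ ∉ {K' : Set V | v ∈ K'} from hv)]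
  rw [hL, h1]
  refine expect_weights_congr T p fun ω hω => ?_
  congr 1
  rw [delConn_eq_expect]
  refine expect_eq_of_dependsOn_of_eqOn (touches ends (cluster ends ω a₂))ᶜ ?_ ?_
  · intro ω₁ ω₂ h12
    simp only
    rw [delConfig_congr (ends := ends) (W := cluster ends ω a₂) h12]
  · intro e he
    have hne : e ∉ T.explored := fun h' => he (hT ω hω e h')
    unfold Explore.Record.weights
    rw [if_neg (fun h' => hne (Finset.mem_union_left _ h')),
      if_neg (fun h' => hne (Finset.mem_union_right _ h'))]

omit [DecidableEq V] [LinearOrder R] [IsStrictOrderedRing R] in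
/-- **The four conditional probabilities**: on a record all of whose explored edges touch `C₂`,
`X_T = E[π₁v(C₂) | T, Q] = P(v ∈ C₁ | T, Q)`. -/
theorem condMean_delConn_eq (T : Explore.Record E) (p : E → R) (ends : E → Sym2 V) (a₁ a₂ v : V)
    (hT : ∀ ω ∈ T.cyl, ∀ e ∈ T.explored, e ∈ touches ends (cluster ends ω a₂)) :
    condMean (T.weights p) (connEvent ends a₂ a₁)ᶜ
        (fun ω => delConn p ends a₁ v (cluster ends ω a₂)) =
      condMean (T.weights p) (connEvent ends a₂ a₁)ᶜ
        (fun ω => (connEvent ends a₁ v).indicator 1 ω) := by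
  unfold condMean
  beta_reduce
  rw [expect_weights_delConn_mul_indicator T p ends a₁ a₂ v hT]

omit [Fintype E] [LinearOrder R] [IsStrictOrderedRing R] [Fintype V] [DecidableEq V] in
/-- The empty record: nothing explored. -/
def emptyRecord : Explore.Record E := ⟨∅, ∅, Finset.disjoint_empty_left ∅⟩

omit [Fintype E] [LinearOrder R] [IsStrictOrderedRing R] [Fintype V] [DecidableEq V] in
/-- The pinned law of the empty record is the law itself. -/
lemma emptyRecord_weights (p : E → R) : (emptyRecord (E := E)).weights p = p := by
  funext e
  simp [emptyRecord, Explore.Record.weights]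

omit [DecidableEq V] [LinearOrder R] [IsStrictOrderedRing R] in
/-- **The centring constants of (PS)**: `E[π₁v(C₂) | Q] = P(v ∈ C₁ | Q)` (the tower identity at
`p` — the empty record). -/
theorem condMean_delConn_eq_prob (p : E → R) (ends : E → Sym2 V) (a₁ a₂ v : V) :
    condMean p (connEvent ends a₂ a₁)ᶜ (fun ω => delConn p ends a₁ v (cluster ends ω a₂)) =
      condMean p (connEvent ends a₂ a₁)ᶜ (fun ω => (connEvent ends a₁ v).indicator 1 ω) := by
  have h := condMean_delConn_eq (emptyRecord (E := E)) p ends a₁ a₂ v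
    (fun _ _ e he => by simp [emptyRecord, Explore.Record.explored] at he)
  rwa [emptyRecord_weights] at h

end Tower

end PSRecords

end Summit.Ventures.PercRepro2
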